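import Literature.MathematicalPhysics.QuantumFieldTheory.Balaban1983to89.B13Core214EntryHolomorphic

/-!
# `Balaban1983to89.B13Term214JetAgreement` — T. Bałaban, *Renormalization group approach to lattice gauge field
theories. II. Cluster expansions*, Commun. Math. Phys. **116** (1988) 1–22 [Balaban1988RG2Cluster], (2.14) p. 15 (with
(2.8) p. 13, (2.1) p. 12) and [I] = Commun. Math. Phys. **109** (1987) 249–301 [Balaban1987RG1], (4.3)–(4.5)
pp. 281–282: THE TERM (2.14) OF `H(Z)` — NODE A's object `B13Term214.term214 r lZ lD (core214 A Γ F) 0 0`, the printed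
Cauchy operators in `σ(Δ)`, `τ(Y)` applied to lines 2–4 — HAS THE SAME SECOND-ORDER JET AT THE BASE CONFIGURATION ON A
TERM's KERNEL FAMILY `𝒦` AND ON ITS JET FAMILY (every entry replaced by its second-order Taylor polynomial at the base
point, `NodeOJetFamily.kjet`): the objects-side half (J2′) of the price of the second-order jet lift «W-jet2», ONE
TERM, completed from the fixed-parameter statement of `B13Core214EntryHolomorphic`

statement-level skeleton of published theorems with citation tags; proofs where landed; nothing here is a claim about
the Yang–Mills mass gap

CITATION HEADER (verbatim, [Balaban1988RG2Cluster] p. 15 [PDF 15], after (2.14)): *"We consider it as an analytic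
function of (𝐔, 𝐉) in the space 𝐔^c_{k+1}(X, α₀, α₁), and of the complex parameters σ(Z), τ."*  [Balaban1987RG1]
p. 281 (4.3): the coefficient of the effective action is read off as a mixed second derivative in the background at the
flat point.

WHY THIS FILE (row (D4) OWNER `b2b-balaban-beta-an4`, gen 118; continuation of `B13Core214EntryHolomorphic`, which
did (J2′) of the cell `ym-nodeO-ideate` (memo `ROUTE-P3.md` v3.15 §0.16, census C88) for lines 2–4 of (2.14) AT FIXED
PARAMETERS `(σ, τ)`).  What was left there: transporting the second-order agreement through the Cauchy operators
`Π∫₀¹ds(Δ)(1/2πi)∮dσ(Δ)/(σ(Δ)−s(Δ))²`, `Π∫₀¹dt(Y)(1/2πi)∮dτ(Y)/(τ(Y)−t(Y))²` of (2.14) (`B13Term214.term214`).  Under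
the printed separate holomorphy in `(σ, τ)` (NODE A's binders `hΨσ hΨτ`, DERIVED in the tree by
`B13Core214HolomorphicCapstone`) the term IS the finite signed corner sum `Σ_{T ⊆ Z∖Z′₀, T′ ⊆ 𝐃} ± Ψ_u(σ_T, τ_{T′})`
(`B13Term214.TopC_eq_DopC`, here with TWO domains of holomorphy: §5 `term214_eq_DopC₂`), i.e. a LINEAR — hence entire —
function of finitely many corner germs `u ↦ Ψ_u(σ_T, τ_{T′})`; each pair of corner germs (family ∕ jet family) agrees
to second order at `u = 0` by `B13Core214EntryHolomorphic` (§6 `core214_jet_agreement_of_holo`, the abstract form),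
and `NodeOJetCalculus.jet_transport_pi` carries the agreement through the linear map.

WHAT IS REPRODUCED:
* §5 `norm_cornerC_zero_le_one`, `cornerC_zero_mem` (corners of `{0,1}^S` over `0`), **`term214_eq_DopC₂`** ((2.14) =
  the (2.8)×(2.1) difference form with the σ on an open `Uσ` and the τ on an open `Uτ`, the shape of NODE A's
  binders; mechanism of `B13CauchyDecay.norm_term214_le`), `DopC_DopC_eq_sum` (the double difference as ONE finite
  signed sum over `↥(𝒫(S) ×ˢ 𝒫(S′))`).
* §6 `core214_jet_agreement_of_holo` (`B13Core214EntryHolomorphic.core214_jet_agreement` with the letter block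
  replaced by its conclusion — an open entry set on which lines 2–4 are a holomorphic function of the entries, met by
  both entry germs), `differentiableOn_core214_cfg` ∕ `differentiableOn_core214_cfg_jet` (the configuration germs of
  lines 2–4 are holomorphic on the ball), and **`term214_jet_agreement`**: under `Jet216R`, the germ letters, `κ₁ ≥ 0`,
  symmetry of the precision on the regime, (J2′)-at-fixed-parameters for every `σ` in the printed polydisc and every
  `|τ(Y)| ≤ 1`, and the printed separate holomorphy of `Ψ_u` for both families and every `u` in the ball:
  `u ↦ term214 r lZ lD Ψ_u 0 0` has the same value, `fderiv` and `mixedDeriv v w` at `u = 0` on `𝒦` and on its jet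
  family.
HONEST SCOPE.  Generic finite-dimensional complex analysis and finite sums; every letter is a HYPOTHESIS of printed
shape (which radius ∕ open sets NODE A's regime supplies for a producer's family is the consumer's); NOT transported:
the finite term sum of Lemma 3 and the linear step (2.13) (objects-side bookkeeping over the term tower of record), and
(J3) — the (1.7)-factorisation of the jet objects; nothing of Bałaban's `Γ_k(Z₀,σ)`, `C^{(k)}(Z₀,σ)` constructed or
asserted; row (D4) instance 0∕1, T⁴ spine 0∕9 UNCHANGED; NOT NODE O, NOT [B12] Thm 2, NOT continuum, NOT mass gap, NOT
Clay.  No `sorry`, no definition, no named fact, no instance, no notation.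
-/

noncomputable section

namespace Literature.MathematicalPhysics.QuantumFieldTheory.Balaban1983to89.B13Term214JetAgreement

open Matrix MeasureTheory Finset Complex Metric Set Filter
open scoped Topology
open B13Term214 (core214 term214 cornerC DopC TopC SepHolOn TopC_congr TopC_eq_DopC)
open B13CauchyDecay (sepHolOn_DopC_inner)
open B13TermWalkData (TermKernels)
open B13JointWalkExpansion (JointWalkExpansion)
open NodeOJetCalculus (jet2 differentiable_jet2 jet_transport_pi)
open NodeOJetFamily (kjet entries Jet216R kjet_A2_isSymm)
open B12Decay510 (mixedDeriv)
open Beta.RemainderLocality (mixedDeriv_congr_of_eqOn_ball)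
open B13Core214EntryHolomorphic (symA linΓ core214_entries)

/-! ## §5 The Cauchy operators of (2.14) with TWO domains of holomorphy: the term is the finite signed corner sum -/

section CornerSum

variable {ι κ E' : Type*} [DecidableEq ι] [DecidableEq κ] [NormedAddCommGroup E'] [NormedSpace ℂ E']

omit [NormedAddCommGroup E'] [NormedSpace ℂ E'] in
/-- A corner of `{0,1}^S` over the base point `0` has every coordinate of norm `≤ 1`. [folklore]
[cite: Balaban1988RG2Cluster, (2.14) p.15] (elementary API for (2.14)) -/
theorem norm_cornerC_zero_le_one (S T : Finset ι) (j : ι) : ‖cornerC S T (0 : ι → ℂ) j‖ ≤ 1 := by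
  unfold cornerC
  split_ifs <;> simp

omit [NormedAddCommGroup E'] [NormedSpace ℂ E'] in
/-- A corner of `{0,1}^S` over the base point `0` has every coordinate in any set containing `0` and `1`. [folklore]
[cite: Balaban1988RG2Cluster, (2.14) p.15] (elementary API for (2.14)) -/
theorem cornerC_zero_mem {U : Set ℂ} (h0 : (0 : ℂ) ∈ U) (h1 : (1 : ℂ) ∈ U) (S T : Finset ι) (j : ι) :
    cornerC S T (0 : ι → ℂ) j ∈ U := by
  unfold cornerC
  split_ifs
  · exact h1
  · exact h0
  · exact h0

/-- **(2.14) = THE (2.8)×(2.1) DIFFERENCE FORM, WITH TWO DOMAINS OF HOLOMORPHY** (`B13Term214.term214_eq_DopC` with the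
σ-parameters holomorphic on an open `Uσ` and the τ-parameters on an open `Uτ`, both containing the closed `r`-discs
about `[0, 1]` — the shape of NODE A's binders `hΨσ`, `hΨτ` in `B13PrimitiveKernels216.h226_torus_of_kernelBounds`;
mechanism of `B13CauchyDecay.norm_term214_le`): the printed iterated Cauchy operators applied to `Ψ(σ, τ)` equal the
double iterated difference over the corners. [cite: Balaban1988RG2Cluster, (2.14) p.15, (2.8) p.13, (2.1) p.12] -/
theorem term214_eq_DopC₂ [CompleteSpace E'] {Uσ Uτ : Set ℂ} (hUσ : IsOpen Uσ) (hUτ : IsOpen Uτ) {r : ℝ}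
    (hr : 0 < r) (hsubσ : ∀ s ∈ Set.uIcc (0 : ℝ) 1, closedBall (s : ℂ) r ⊆ Uσ)
    (hsubτ : ∀ s ∈ Set.uIcc (0 : ℝ) 1, closedBall (s : ℂ) r ⊆ Uτ) {Ψ : (ι → ℂ) → (κ → ℂ) → E'}
    (hΨσ : ∀ τ : κ → ℂ, (∀ j, τ j ∈ Uτ) → SepHolOn Uσ (fun σ => Ψ σ τ))
    (hΨτ : ∀ σ : ι → ℂ, (∀ j, σ j ∈ Uσ) → SepHolOn Uτ (fun τ => Ψ σ τ))
    {lZ : List ι} (hlZ : lZ.Nodup) {lD : List κ} (hlD : lD.Nodup)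
    {σ₀ : ι → ℂ} (hσ₀ : ∀ j, σ₀ j ∈ Uσ) {τ₀ : κ → ℂ} (hτ₀ : ∀ j, τ₀ j ∈ Uτ) :
    term214 r lZ lD Ψ σ₀ τ₀ = DopC lZ.toFinset (fun σ => DopC lD.toFinset (fun τ => Ψ σ τ) τ₀) σ₀ := by
  have h0τ : (0 : ℂ) ∈ Uτ := by simpa using hsubτ 0 (by simp) (mem_closedBall_self hr.le)
  have h1τ : (1 : ℂ) ∈ Uτ := by simpa using hsubτ 1 (by simp) (mem_closedBall_self hr.le)
  have hinner : ∀ σ : ι → ℂ, (∀ j, σ j ∈ Uσ) →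
      TopC r lD (fun τ => Ψ σ τ) τ₀ = DopC lD.toFinset (fun τ => Ψ σ τ) τ₀ :=
    fun σ hσ => TopC_eq_DopC hUτ hr hsubτ (hΨτ σ hσ) lD hlD τ₀ hτ₀
  unfold term214
  rw [TopC_congr hr hsubσ hinner lZ σ₀ hσ₀]
  exact TopC_eq_DopC hUσ hr hsubσ (sepHolOn_DopC_inner h0τ h1τ hΨσ lD.toFinset hτ₀) lZ hlZ σ₀ hσ₀

/-- The double iterated difference as ONE finite signed sum over the corner pairs, indexed by the finite type
`↥(𝒫(S) ×ˢ 𝒫(S′))`. [folklore] [cite: Balaban1988RG2Cluster, (2.14) p.15] (elementary API for (2.14)) -/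
theorem DopC_DopC_eq_sum (S : Finset ι) (S' : Finset κ)
    (Ψ : (ι → ℂ) → (κ → ℂ) → E') (p : ι → ℂ) (q : κ → ℂ) :
    DopC S (fun σ => DopC S' (fun τ => Ψ σ τ) q) p
      = ∑ x : ↥(S.powerset ×ˢ S'.powerset),
          (((-1 : ℂ) ^ (S \ x.1.1).card) * ((-1 : ℂ) ^ (S' \ x.1.2).card))
            • Ψ (cornerC S x.1.1 p) (cornerC S' x.1.2 q) := by
  have h1 : DopC S (fun σ => DopC S' (fun τ => Ψ σ τ) q) p
      = ∑ T ∈ S.powerset, ∑ T' ∈ S'.powerset,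
          (((-1 : ℂ) ^ (S \ T).card) * ((-1 : ℂ) ^ (S' \ T').card)) • Ψ (cornerC S T p) (cornerC S' T' q) := by
    unfold DopC
    refine Finset.sum_congr rfl fun T _ => ?_
    rw [Finset.smul_sum]
    refine Finset.sum_congr rfl fun T' _ => ?_
    rw [smul_smul]
  have h2 := Finset.sum_product' S.powerset S'.powerset
    (fun T T' => (((-1 : ℂ) ^ (S \ T).card) * ((-1 : ℂ) ^ (S' \ T').card)) • Ψ (cornerC S T p) (cornerC S' T' q))
  have h3 := Finset.sum_coe_sort (s := S.powerset ×ˢ S'.powerset)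
    (f := fun x => (((-1 : ℂ) ^ (S \ x.1).card) * ((-1 : ℂ) ^ (S' \ x.2).card)) • Ψ (cornerC S x.1 p) (cornerC S' x.2 q))
  rw [h1, ← h2, ← h3]

end CornerSum

/-! ## §6 THE TERM (2.14) at the base points on the jet family: the same second-order jet at the base configuration -/

section Term

variable {c : B13.Consts} {d N' ν : ℕ} {Nf : Fin ν → ℕ} [∀ i, NeZero (Nf i)]
variable {E : Type*} [NormedAddCommGroup E] [NormedSpace ℂ E]

/-- **LINES 2–4 ON THE JET FAMILY, ABSTRACT FORM** (`core214_jet_agreement` with the letter block replaced by its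
conclusion: an open entry set `V` on which `e ↦ core214 symA linΓ F e τ` is holomorphic and into which both entry
germs map the ball — dischargeable by `differentiableOn_core214_entries`).
[cite: Balaban1987RG1, (4.3)–(4.5) pp.281–282; Balaban1988RG2Cluster, (2.14)–(2.16) pp.15–16; Chae1985, Thm 14.13] -/
theorem core214_jet_agreement_of_holo (𝒦 : TermKernels c d N' ν Nf E) [Fintype 𝒦.C₀] [DecidableEq 𝒦.C₀]
    {kap KΓ K₀ θΓ θE K₁ K₂ : ℝ} (h : Jet216R 𝒦 kap KΓ K₀ θΓ θE K₁ K₂) {ρ : ℝ} (hρ : 0 < ρ)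
    (haE : JointWalkExpansion.AnalyticOnBall c 𝒦.A2 ρ) (haΓ : JointWalkExpansion.AnalyticOnBall c 𝒦.G2 ρ)
    (σ : TreeLengthTorus.TPt d N' → ℂ) (hσ : ∀ j, ‖σ j‖ ≤ Real.exp c.κ₁)
    (hs : ∀ u ∈ ball (0 : E) ρ, (𝒦.A2 σ u).IsSymm)
    {D : Type*} (F : (D → ℂ) → (𝒦.Λ → ℝ) → ℂ) (τ : D → ℂ)
    {V : Set ((𝒦.Λ × (𝒦.Λ ⊕ 𝒦.C₀)) ⊕ (𝒦.Λ × 𝒦.Λ) → ℂ)} (hV : IsOpen V)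
    (hΦ : DifferentiableOn ℂ (fun e => core214 symA linΓ F e τ) V)
    (hkV : MapsTo (entries 𝒦 σ) (ball 0 ρ) V) (hk'V : MapsTo (entries (kjet 𝒦) σ) (ball 0 ρ) V) :
    (core214 (fun σ' => 𝒦.A2 σ' (0 : E)) (fun σ' X => 𝒦.G2 σ' (0 : E) *ᵥ fun j => (X j : ℂ)) F σ τ
        = core214 (fun σ' => Matrix.of fun b b' => jet2 (fun u' => 𝒦.A2 σ' u' b b') (0 : E))
            (fun σ' X => (Matrix.of fun b j => jet2 (fun u' => 𝒦.G2 σ' u' b j) (0 : E)) *ᵥ fun j => (X j : ℂ))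
            F σ τ) ∧
      fderiv ℂ (fun u : E => core214 (fun σ' => 𝒦.A2 σ' u) (fun σ' X => 𝒦.G2 σ' u *ᵥ fun j => (X j : ℂ)) F σ τ) 0
        = fderiv ℂ (fun u : E => core214 (fun σ' => Matrix.of fun b b' => jet2 (fun u' => 𝒦.A2 σ' u' b b') u)
            (fun σ' X => (Matrix.of fun b j => jet2 (fun u' => 𝒦.G2 σ' u' b j) u) *ᵥ fun j => (X j : ℂ))
            F σ τ) 0 ∧
      ∀ v w : E,
        mixedDeriv (fun u : E => core214 (fun σ' => 𝒦.A2 σ' u) (fun σ' X => 𝒦.G2 σ' u *ᵥ fun j => (X j : ℂ)) F σ τ)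
            v w
          = mixedDeriv (fun u : E => core214 (fun σ' => Matrix.of fun b b' => jet2 (fun u' => 𝒦.A2 σ' u' b b') u)
              (fun σ' X => (Matrix.of fun b j => jet2 (fun u' => 𝒦.G2 σ' u' b j) u) *ᵥ fun j => (X j : ℂ))
              F σ τ) v w := by
  letI : Fintype (kjet 𝒦).C₀ := ‹Fintype 𝒦.C₀›
  letI : DecidableEq (kjet 𝒦).C₀ := ‹DecidableEq 𝒦.C₀›
  obtain ⟨h0, h1, h2⟩ := h.objects_jet_agreement hρ haE haΓ σ hσ hV hΦ hkV hk'V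
  have hfam : EqOn ((fun e : (𝒦.Λ × (𝒦.Λ ⊕ 𝒦.C₀)) ⊕ (𝒦.Λ × 𝒦.Λ) → ℂ => core214 symA linΓ F e τ)
        ∘ entries 𝒦 σ)
      (fun u : E => core214 (fun σ' => 𝒦.A2 σ' u) (fun σ' X => 𝒦.G2 σ' u *ᵥ fun j => (X j : ℂ)) F σ τ)
      (ball 0 ρ) := fun u hu => core214_entries 𝒦 F σ τ u (hs u hu)
  have hjet : ((fun e : (𝒦.Λ × (𝒦.Λ ⊕ 𝒦.C₀)) ⊕ (𝒦.Λ × 𝒦.Λ) → ℂ => core214 symA linΓ F e τ)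
        ∘ entries (kjet 𝒦) σ)
      = (fun u : E => core214 (fun σ' => Matrix.of fun b b' => jet2 (fun u' => 𝒦.A2 σ' u' b b') u)
          (fun σ' X => (Matrix.of fun b j => jet2 (fun u' => 𝒦.G2 σ' u' b j) u) *ᵥ fun j => (X j : ℂ))
          F σ τ) :=
    funext fun v => core214_entries (kjet 𝒦) F σ τ v (kjet_A2_isSymm 𝒦 σ hρ hs v)
  have hfamev : ((fun e : (𝒦.Λ × (𝒦.Λ ⊕ 𝒦.C₀)) ⊕ (𝒦.Λ × 𝒦.Λ) → ℂ => core214 symA linΓ F e τ)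
        ∘ entries 𝒦 σ)
      =ᶠ[𝓝 (0 : E)] (fun u : E => core214 (fun σ' => 𝒦.A2 σ' u)
        (fun σ' X => 𝒦.G2 σ' u *ᵥ fun j => (X j : ℂ)) F σ τ) :=
    hfam.eventuallyEq_of_mem (isOpen_ball.mem_nhds (mem_ball_self hρ))
  refine ⟨?_, ?_, fun v w => ?_⟩
  · exact ((hfam (mem_ball_self hρ)).symm.trans h0).trans (congrFun hjet 0)
  · rw [← hfamev.fderiv_eq, ← hjet]; exact h1
  · rw [← mixedDeriv_congr_of_eqOn_ball hρ hfam v w, ← hjet]; exact h2 v w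

/-- On the ball, `u ↦` lines 2–4 of (2.14) for the term at `(σ, u)` is holomorphic — the composite of the holomorphic
entry function with the holomorphic entry germ. [cite: Balaban1988RG2Cluster, (2.14)–(2.16) pp.15–16] -/
theorem differentiableOn_core214_cfg (𝒦 : TermKernels c d N' ν Nf E) [Fintype 𝒦.C₀] [DecidableEq 𝒦.C₀]
    {ρ : ℝ} (haE : JointWalkExpansion.AnalyticOnBall c 𝒦.A2 ρ) (haΓ : JointWalkExpansion.AnalyticOnBall c 𝒦.G2 ρ)
    (σ : TreeLengthTorus.TPt d N' → ℂ) (hσ : ∀ j, ‖σ j‖ ≤ Real.exp c.κ₁)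
    (hs : ∀ u ∈ ball (0 : E) ρ, (𝒦.A2 σ u).IsSymm)
    {D : Type*} (F : (D → ℂ) → (𝒦.Λ → ℝ) → ℂ) (τ : D → ℂ)
    {V : Set ((𝒦.Λ × (𝒦.Λ ⊕ 𝒦.C₀)) ⊕ (𝒦.Λ × 𝒦.Λ) → ℂ)}
    (hΦ : DifferentiableOn ℂ (fun e => core214 symA linΓ F e τ) V)
    (hkV : MapsTo (entries 𝒦 σ) (ball 0 ρ) V) :
    DifferentiableOn ℂ
      (fun u : E => core214 (fun σ' => 𝒦.A2 σ' u) (fun σ' X => 𝒦.G2 σ' u *ᵥ fun j => (X j : ℂ)) F σ τ)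
      (ball 0 ρ) := by
  have hent : DifferentiableOn ℂ (entries 𝒦 σ) (ball 0 ρ) := by
    refine differentiableOn_pi.2 ?_
    rintro (⟨b, j⟩ | ⟨b, b'⟩)
    · exact haΓ σ hσ b j
    · exact haE σ hσ b b'
  refine (hΦ.comp hent hkV).congr fun u hu => ?_
  exact (core214_entries 𝒦 F σ τ u (hs u hu)).symm

/-- On the whole configuration space, `u ↦` lines 2–4 of (2.14) for the JET family at `(σ, u)` is holomorphic on the
ball (the jet entries are entire: `NodeOJetCalculus.differentiable_jet2`). [cite: Balaban1988RG2Cluster, (2.14)–(2.16) pp.15–16] -/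
theorem differentiableOn_core214_cfg_jet (𝒦 : TermKernels c d N' ν Nf E) [Fintype 𝒦.C₀] [DecidableEq 𝒦.C₀]
    {kap KΓ K₀ θΓ θE K₁ K₂ : ℝ} (h : Jet216R 𝒦 kap KΓ K₀ θΓ θE K₁ K₂) {ρ : ℝ} (hρ : 0 < ρ)
    (haE : JointWalkExpansion.AnalyticOnBall c 𝒦.A2 ρ) (haΓ : JointWalkExpansion.AnalyticOnBall c 𝒦.G2 ρ)
    (σ : TreeLengthTorus.TPt d N' → ℂ) (hσ : ∀ j, ‖σ j‖ ≤ Real.exp c.κ₁)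
    (hs : ∀ u ∈ ball (0 : E) ρ, (𝒦.A2 σ u).IsSymm)
    {D : Type*} (F : (D → ℂ) → (𝒦.Λ → ℝ) → ℂ) (τ : D → ℂ)
    {V : Set ((𝒦.Λ × (𝒦.Λ ⊕ 𝒦.C₀)) ⊕ (𝒦.Λ × 𝒦.Λ) → ℂ)}
    (hΦ : DifferentiableOn ℂ (fun e => core214 symA linΓ F e τ) V)
    (hk'V : MapsTo (entries (kjet 𝒦) σ) (ball 0 ρ) V) :
    DifferentiableOn ℂ
      (fun u : E => core214 (fun σ' => Matrix.of fun b b' => jet2 (fun u' => 𝒦.A2 σ' u' b b') u)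
        (fun σ' X => (Matrix.of fun b j => jet2 (fun u' => 𝒦.G2 σ' u' b j) u) *ᵥ fun j => (X j : ℂ)) F σ τ)
      (ball 0 ρ) := by
  letI : Fintype (kjet 𝒦).C₀ := ‹Fintype 𝒦.C₀›
  letI : DecidableEq (kjet 𝒦).C₀ := ‹DecidableEq 𝒦.C₀›
  have hent : DifferentiableOn ℂ (entries (kjet 𝒦) σ) (ball 0 ρ) := by
    refine differentiableOn_pi.2 ?_
    rintro (⟨b, j⟩ | ⟨b, b'⟩)
    · exact ((differentiable_jet2 hρ (haΓ σ hσ b j) (fun v w => h.d2Γ σ hσ b j v w)).differentiableOn :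
        DifferentiableOn ℂ (jet2 fun u => 𝒦.G2 σ u b j) (ball 0 ρ))
    · exact ((differentiable_jet2 hρ (haE σ hσ b b') (fun v w => h.d2E σ hσ b b' v w)).differentiableOn :
        DifferentiableOn ℂ (jet2 fun u => 𝒦.A2 σ u b b') (ball 0 ρ))
  refine ((hΦ.comp hent hk'V).congr fun u _ => ?_)
  exact (core214_entries (kjet 𝒦) F σ τ u (kjet_A2_isSymm 𝒦 σ hρ hs u)).symm

/-- **THE TERM (2.14) HAS THE SAME SECOND-ORDER JET AT THE BASE CONFIGURATION ON A TERM'S KERNEL FAMILY AND ON ITS JET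
FAMILY** — (J2′) for NODE A's object `B13Term214.term214 r lZ lD (core214 A Γ F) 0 0` (the conclusion's object of
`B13PrimitiveKernels216.h226_torus_of_kernelBounds`).  Hypotheses: the jet record `Jet216R`, the germ letters
`haE haΓ` on the `ρ`-ball, `κ₁ ≥ 0` (so the corners `{0,1}^ι` lie in the printed polydisc `|σ| ≤ e^{κ₁}`), symmetry of
the precision on the regime (NODE A's `hAs`); for every `σ` in the polydisc and every `τ` with `|τ(Y)| ≤ 1` an OPEN
entry set on which lines 2–4 are a holomorphic function of the entries, met by both entry germs (§2
`differentiableOn_core214_entries` — (J2′) at fixed parameters); and, for every configuration `u` in the ball, the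
printed separate holomorphy of `(σ, τ) ↦ Ψ_u(σ, τ)` = lines 2–4 (p. 15 *"analytic function … of the complex
parameters σ(Z), τ"*: NODE A's binders `hΨσ hΨτ` with two opens `Uσ ⊇`, `Uτ ⊇` the closed `r`-discs about `[0,1]`,
DERIVED in the tree by `B13Core214HolomorphicCapstone`) for BOTH families.  Then the functions
`u ↦ term214 r lZ lD Ψ_u 0 0` of `𝒦` and of its jet family have the same value, the same `fderiv` and the same
`mixedDeriv v w` at `u = 0` ([I] (4.3): the three read-outs of the (D4) wall).  Mechanism: on the ball each is the
FINITE signed corner sum `Σ_{T,T′} ± Ψ_u(σ_T, τ_{T′})` (`term214_eq_DopC₂`, `DopC_DopC_eq_sum`), i.e. a LINEAR (entire)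
function of finitely many corner germs, each pair of corner germs agreeing to second order at `u = 0`
(`core214_jet_agreement_of_holo`); `NodeOJetCalculus.jet_transport_pi`.  NOT transported: Lemma 3's finite term sum
and (2.13) (objects-side bookkeeping over the term tower), (J3).
[cite: Balaban1988RG2Cluster, (2.14) p.15, (2.8) p.13, (2.1) p.12, (2.16) p.16; Balaban1987RG1, (4.3)–(4.5) pp.281–282;
Chae1985, Thm 14.13] -/
theorem term214_jet_agreement (𝒦 : TermKernels c d N' ν Nf E) [Fintype 𝒦.C₀] [DecidableEq 𝒦.C₀]
    {kap KΓ K₀ θΓ θE K₁ K₂ : ℝ} (h : Jet216R 𝒦 kap KΓ K₀ θΓ θE K₁ K₂) (hκ₁ : 0 ≤ c.κ₁) {ρ : ℝ} (hρ : 0 < ρ)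
    (haE : JointWalkExpansion.AnalyticOnBall c 𝒦.A2 ρ) (haΓ : JointWalkExpansion.AnalyticOnBall c 𝒦.G2 ρ)
    (hs : ∀ σ : TreeLengthTorus.TPt d N' → ℂ, (∀ j, ‖σ j‖ ≤ Real.exp c.κ₁) →
      ∀ u ∈ ball (0 : E) ρ, (𝒦.A2 σ u).IsSymm)
    {D : Type*} [DecidableEq D] (F : (D → ℂ) → (𝒦.Λ → ℝ) → ℂ)
    (hΦ : ∀ σ : TreeLengthTorus.TPt d N' → ℂ, (∀ j, ‖σ j‖ ≤ Real.exp c.κ₁) → ∀ τ : D → ℂ, (∀ j, ‖τ j‖ ≤ 1) →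
      ∃ V : Set ((𝒦.Λ × (𝒦.Λ ⊕ 𝒦.C₀)) ⊕ (𝒦.Λ × 𝒦.Λ) → ℂ), IsOpen V ∧
        DifferentiableOn ℂ (fun e => core214 symA linΓ F e τ) V ∧
        MapsTo (entries 𝒦 σ) (ball 0 ρ) V ∧ MapsTo (entries (kjet 𝒦) σ) (ball 0 ρ) V)
    {Uσ Uτ : Set ℂ} (hUσ : IsOpen Uσ) (hUτ : IsOpen Uτ) {r : ℝ} (hr : 0 < r)
    (hsubσ : ∀ s ∈ Set.uIcc (0 : ℝ) 1, closedBall (s : ℂ) r ⊆ Uσ)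
    (hsubτ : ∀ s ∈ Set.uIcc (0 : ℝ) 1, closedBall (s : ℂ) r ⊆ Uτ)
    (hΨσ : ∀ u ∈ ball (0 : E) ρ, ∀ τ : D → ℂ, (∀ j, τ j ∈ Uτ) → SepHolOn Uσ
      (fun σ => core214 (fun σ' => 𝒦.A2 σ' u) (fun σ' X => 𝒦.G2 σ' u *ᵥ fun j => (X j : ℂ)) F σ τ))
    (hΨτ : ∀ u ∈ ball (0 : E) ρ, ∀ σ : TreeLengthTorus.TPt d N' → ℂ, (∀ j, σ j ∈ Uσ) → SepHolOn Uτ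
      (fun τ => core214 (fun σ' => 𝒦.A2 σ' u) (fun σ' X => 𝒦.G2 σ' u *ᵥ fun j => (X j : ℂ)) F σ τ))
    (hΨσ' : ∀ u ∈ ball (0 : E) ρ, ∀ τ : D → ℂ, (∀ j, τ j ∈ Uτ) → SepHolOn Uσ
      (fun σ => core214 (fun σ' => Matrix.of fun b b' => jet2 (fun u' => 𝒦.A2 σ' u' b b') u)
        (fun σ' X => (Matrix.of fun b j => jet2 (fun u' => 𝒦.G2 σ' u' b j) u) *ᵥ fun j => (X j : ℂ)) F σ τ))
    (hΨτ' : ∀ u ∈ ball (0 : E) ρ, ∀ σ : TreeLengthTorus.TPt d N' → ℂ, (∀ j, σ j ∈ Uσ) → SepHolOn Uτ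
      (fun τ => core214 (fun σ' => Matrix.of fun b b' => jet2 (fun u' => 𝒦.A2 σ' u' b b') u)
        (fun σ' X => (Matrix.of fun b j => jet2 (fun u' => 𝒦.G2 σ' u' b j) u) *ᵥ fun j => (X j : ℂ)) F σ τ))
    {lZ : List (TreeLengthTorus.TPt d N')} (hlZ : lZ.Nodup) {lD : List D} (hlD : lD.Nodup) :
    (term214 r lZ lD
          (core214 (fun σ' => 𝒦.A2 σ' (0 : E)) (fun σ' X => 𝒦.G2 σ' (0 : E) *ᵥ fun j => (X j : ℂ)) F) 0 0
        = term214 r lZ lD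
          (core214 (fun σ' => Matrix.of fun b b' => jet2 (fun u' => 𝒦.A2 σ' u' b b') (0 : E))
            (fun σ' X => (Matrix.of fun b j => jet2 (fun u' => 𝒦.G2 σ' u' b j) (0 : E)) *ᵥ fun j => (X j : ℂ)) F)
          0 0) ∧
      fderiv ℂ (fun u : E => term214 r lZ lD
          (core214 (fun σ' => 𝒦.A2 σ' u) (fun σ' X => 𝒦.G2 σ' u *ᵥ fun j => (X j : ℂ)) F) 0 0) 0
        = fderiv ℂ (fun u : E => term214 r lZ lD
          (core214 (fun σ' => Matrix.of fun b b' => jet2 (fun u' => 𝒦.A2 σ' u' b b') u)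
            (fun σ' X => (Matrix.of fun b j => jet2 (fun u' => 𝒦.G2 σ' u' b j) u) *ᵥ fun j => (X j : ℂ)) F)
          0 0) 0 ∧
      ∀ v w : E,
        mixedDeriv (fun u : E => term214 r lZ lD
            (core214 (fun σ' => 𝒦.A2 σ' u) (fun σ' X => 𝒦.G2 σ' u *ᵥ fun j => (X j : ℂ)) F) 0 0) v w
          = mixedDeriv (fun u : E => term214 r lZ lD
            (core214 (fun σ' => Matrix.of fun b b' => jet2 (fun u' => 𝒦.A2 σ' u' b b') u)
              (fun σ' X => (Matrix.of fun b j => jet2 (fun u' => 𝒦.G2 σ' u' b j) u) *ᵥ fun j => (X j : ℂ)) F)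
            0 0) v w := by
  -- the two configuration-indexed parameter functions `Ψ_u(σ, τ)` (family ∕ jet family)
  set ΨK : E → (TreeLengthTorus.TPt d N' → ℂ) → (D → ℂ) → ℂ := fun u =>
    core214 (fun σ' => 𝒦.A2 σ' u) (fun σ' X => 𝒦.G2 σ' u *ᵥ fun j => (X j : ℂ)) F with hΨK
  set ΨJ : E → (TreeLengthTorus.TPt d N' → ℂ) → (D → ℂ) → ℂ := fun u =>
    core214 (fun σ' => Matrix.of fun b b' => jet2 (fun u' => 𝒦.A2 σ' u' b b') u)
      (fun σ' X => (Matrix.of fun b j => jet2 (fun u' => 𝒦.G2 σ' u' b j) u) *ᵥ fun j => (X j : ℂ)) F with hΨJ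
  -- base points and corners
  have h0σ : ∀ j, (0 : TreeLengthTorus.TPt d N' → ℂ) j ∈ Uσ := fun j => by
    simpa using hsubσ 0 (by simp) (mem_closedBall_self hr.le)
  have h0τ : ∀ j, (0 : D → ℂ) j ∈ Uτ := fun j => by
    simpa using hsubτ 0 (by simp) (mem_closedBall_self hr.le)
  have h1exp : (1 : ℝ) ≤ Real.exp c.κ₁ := by simpa using Real.one_le_exp hκ₁
  -- step 1: on the ball both terms are the finite signed corner sums
  set S := lZ.toFinset with hS
  set S' := lD.toFinset with hS'
  have keyK : ∀ u ∈ ball (0 : E) ρ, term214 r lZ lD (ΨK u) 0 0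
      = DopC S (fun σ => DopC S' (fun τ => ΨK u σ τ) 0) 0 :=
    fun u hu => term214_eq_DopC₂ hUσ hUτ hr hsubσ hsubτ (hΨσ u hu) (hΨτ u hu) hlZ hlD h0σ h0τ
  have keyJ : ∀ u ∈ ball (0 : E) ρ, term214 r lZ lD (ΨJ u) 0 0
      = DopC S (fun σ => DopC S' (fun τ => ΨJ u σ τ) 0) 0 :=
    fun u hu => term214_eq_DopC₂ hUσ hUτ hr hsubσ hsubτ (hΨσ' u hu) (hΨτ' u hu) hlZ hlD h0σ h0τ
  -- step 2: the corner sum is a LINEAR (entire) function of the finitely many corner germs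
  let I := ↥(S.powerset ×ˢ S'.powerset)
  let coef : I → ℂ := fun x => ((-1 : ℂ) ^ (S \ x.1.1).card) * ((-1 : ℂ) ^ (S' \ x.1.2).card)
  let Φ : (I → ℂ) → ℂ := fun x => ∑ i : I, coef i • x i
  let k : E → I → ℂ := fun u i => ΨK u (cornerC S i.1.1 0) (cornerC S' i.1.2 0)
  let k' : E → I → ℂ := fun u i => ΨJ u (cornerC S i.1.1 0) (cornerC S' i.1.2 0)
  have hΦk : ∀ u, (Φ ∘ k) u = DopC S (fun σ => DopC S' (fun τ => ΨK u σ τ) 0) 0 :=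
    fun u => (DopC_DopC_eq_sum S S' (ΨK u) 0 0).symm
  have hΦk' : ∀ u, (Φ ∘ k') u = DopC S (fun σ => DopC S' (fun τ => ΨJ u σ τ) 0) 0 :=
    fun u => (DopC_DopC_eq_sum S S' (ΨJ u) 0 0).symm
  have hΦd : DifferentiableOn ℂ Φ univ := by
    refine (Differentiable.fun_sum fun i _ => ?_).differentiableOn
    have hi : Differentiable ℂ fun x : I → ℂ => x i := differentiable_apply _
    exact hi.const_smul (coef i)
  -- the corners lie in the printed polydisc and in `Uσ` ∕ `Uτ`
  have hσc : ∀ T : Finset (TreeLengthTorus.TPt d N'), ∀ j,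
      ‖cornerC S T (0 : TreeLengthTorus.TPt d N' → ℂ) j‖ ≤ Real.exp c.κ₁ :=
    fun T j => (norm_cornerC_zero_le_one S T j).trans h1exp
  have hτc : ∀ T' : Finset D, ∀ j, ‖cornerC S' T' (0 : D → ℂ) j‖ ≤ 1 :=
    fun T' j => norm_cornerC_zero_le_one S' T' j
  -- step 3: per corner pair, holomorphy on the ball and second-order agreement at `u = 0`
  have hcorner : ∀ i : I,
      DifferentiableOn ℂ (fun u => k u i) (ball 0 ρ) ∧ DifferentiableOn ℂ (fun u => k' u i) (ball 0 ρ) ∧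
      k 0 i = k' 0 i ∧ fderiv ℂ (fun u => k u i) 0 = fderiv ℂ (fun u => k' u i) 0 ∧
      ∀ v w : E, mixedDeriv (fun u => k u i) v w = mixedDeriv (fun u => k' u i) v w := by
    intro i
    obtain ⟨V, hV, hΦV, hkV, hk'V⟩ := hΦ (cornerC S i.1.1 0) (hσc i.1.1) (cornerC S' i.1.2 0) (hτc i.1.2)
    have hsi := hs (cornerC S i.1.1 0) (hσc i.1.1)
    obtain ⟨a0, a1, a2⟩ := core214_jet_agreement_of_holo 𝒦 h hρ haE haΓ (cornerC S i.1.1 0) (hσc i.1.1) hsi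
      F (cornerC S' i.1.2 0) hV hΦV hkV hk'V
    exact ⟨differentiableOn_core214_cfg 𝒦 haE haΓ (cornerC S i.1.1 0) (hσc i.1.1) hsi F (cornerC S' i.1.2 0)
        hΦV hkV,
      differentiableOn_core214_cfg_jet 𝒦 h hρ haE haΓ (cornerC S i.1.1 0) (hσc i.1.1) hsi F
        (cornerC S' i.1.2 0) hΦV hk'V, a0, a1, a2⟩
  obtain ⟨j0, j1, j2⟩ := jet_transport_pi (Φ := Φ) (k := k) (k' := k') isOpen_univ hΦd hρ
    (fun i => (hcorner i).1) (fun i => (hcorner i).2.1) (mapsTo_univ _ _) (mapsTo_univ _ _)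
    (fun i => (hcorner i).2.2.1) (fun i => (hcorner i).2.2.2.1) (fun i => (hcorner i).2.2.2.2)
  -- step 4: transfer from `Φ ∘ k`, `Φ ∘ k'` to the two terms (equal on the ball)
  have eK : EqOn (Φ ∘ k) (fun u => term214 r lZ lD (ΨK u) 0 0) (ball 0 ρ) :=
    fun u hu => (hΦk u).trans (keyK u hu).symm
  have eJ : EqOn (Φ ∘ k') (fun u => term214 r lZ lD (ΨJ u) 0 0) (ball 0 ρ) :=
    fun u hu => (hΦk' u).trans (keyJ u hu).symm
  have eKev : (Φ ∘ k) =ᶠ[𝓝 (0 : E)] (fun u => term214 r lZ lD (ΨK u) 0 0) :=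
    eK.eventuallyEq_of_mem (isOpen_ball.mem_nhds (mem_ball_self hρ))
  have eJev : (Φ ∘ k') =ᶠ[𝓝 (0 : E)] (fun u => term214 r lZ lD (ΨJ u) 0 0) :=
    eJ.eventuallyEq_of_mem (isOpen_ball.mem_nhds (mem_ball_self hρ))
  refine ⟨?_, ?_, fun v w => ?_⟩
  · exact ((eK (mem_ball_self hρ)).symm.trans j0).trans (eJ (mem_ball_self hρ))
  · rw [← eKev.fderiv_eq, ← eJev.fderiv_eq]; exact j1
  · rw [← mixedDeriv_congr_of_eqOn_ball hρ eK v w, ← mixedDeriv_congr_of_eqOn_ball hρ eJ v w]; exact j2 v w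

end Term

/-! ## §7 (v1.1, append-only) Finite linear combinations: the shape of Lemma 3's term sum and of the linear (2.13) -/

section LinearCombination

variable {E : Type*} [NormedAddCommGroup E] [NormedSpace ℂ E]

/-- **SECOND-ORDER AGREEMENT AT THE BASE CONFIGURATION PASSES THROUGH FINITE LINEAR COMBINATIONS** — the remaining
objects-side steps of (J2′) have this shape: `H(Z) = Σ_{(𝐃,P)} (2.14)` (Lemma 3, a FINITE sum on a finite torus,
[Balaban1988RG2Cluster] p. 15 ∕ (2.38) p. 20) and the LINEAR passage (2.13) p. 14 from `H` to `𝐄`.  If two finite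
families of configuration germs `f_t`, `g_t` are holomorphic on a ball around `0` and agree termwise to second order at
`0` (value, `fderiv`, `mixedDeriv`), then so do `u ↦ Σ_{t ∈ s} c_t f_t(u)` and `u ↦ Σ_{t ∈ s} c_t g_t(u)`
(`NodeOJetCalculus.jet_transport_pi` with the linear map `x ↦ Σ_t c_t x_t` on `ℂ^{↥s}`). [folklore]
[cite: Balaban1988RG2Cluster, (2.13) p.14, (2.38) p.20; Balaban1987RG1, (4.3) p.281] -/
theorem jet_agreement_sum {T : Type*} (s : Finset T) (coef : T → ℂ) {f g : T → E → ℂ} {ρ : ℝ} (hρ : 0 < ρ)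
    (hf : ∀ t ∈ s, DifferentiableOn ℂ (f t) (ball 0 ρ)) (hg : ∀ t ∈ s, DifferentiableOn ℂ (g t) (ball 0 ρ))
    (h0 : ∀ t ∈ s, f t 0 = g t 0) (h1 : ∀ t ∈ s, fderiv ℂ (f t) 0 = fderiv ℂ (g t) 0)
    (h2 : ∀ t ∈ s, ∀ v w : E, mixedDeriv (f t) v w = mixedDeriv (g t) v w) :
    (∑ t ∈ s, coef t * f t 0 = ∑ t ∈ s, coef t * g t 0) ∧
      fderiv ℂ (fun u => ∑ t ∈ s, coef t * f t u) 0 = fderiv ℂ (fun u => ∑ t ∈ s, coef t * g t u) 0 ∧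
      ∀ v w : E, mixedDeriv (fun u => ∑ t ∈ s, coef t * f t u) v w
        = mixedDeriv (fun u => ∑ t ∈ s, coef t * g t u) v w := by
  let Φ : (↥s → ℂ) → ℂ := fun x => ∑ i : ↥s, coef i.1 * x i
  let k : E → ↥s → ℂ := fun u i => f i.1 u
  let k' : E → ↥s → ℂ := fun u i => g i.1 u
  have hΦd : DifferentiableOn ℂ Φ univ := by
    refine (Differentiable.fun_sum fun i _ => ?_).differentiableOn
    have hi : Differentiable ℂ fun x : ↥s → ℂ => x i := differentiable_apply _
    exact hi.const_mul _
  have hΦk : (Φ ∘ k) = fun u => ∑ t ∈ s, coef t * f t u :=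
    funext fun u => Finset.sum_coe_sort (s := s) (f := fun t => coef t * f t u)
  have hΦk' : (Φ ∘ k') = fun u => ∑ t ∈ s, coef t * g t u :=
    funext fun u => Finset.sum_coe_sort (s := s) (f := fun t => coef t * g t u)
  obtain ⟨j0, j1, j2⟩ := jet_transport_pi (Φ := Φ) (k := k) (k' := k') isOpen_univ hΦd hρ
    (fun i => hf i.1 i.2) (fun i => hg i.1 i.2) (mapsTo_univ _ _) (mapsTo_univ _ _)
    (fun i => h0 i.1 i.2) (fun i => h1 i.1 i.2) (fun i => h2 i.1 i.2)
  rw [hΦk, hΦk'] at j0 j1 j2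
  exact ⟨j0, j1, j2⟩

end LinearCombination

end Literature.MathematicalPhysics.QuantumFieldTheory.Balaban1983to89.B13Term214JetAgreement

end
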